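import Summits.KontsevichZagierPeriods.KontsevichZagierPeriods.Theorems.LiouvilleUnfoldingUnfoldedLogStokesStubVelocityExtension
import Literature.NumberTheory.Transcendental.KZLogCalculusProofs

/-!
# `LogPrimitiveNL` (stmt-KontsevichZagierPeriods-2836) — line `logderiv-peeling`,
stub `stub_transfer` (T2, transfer), auxiliary file 1/2: one min-normalised instance of the tree engine

The stub `stub_transfer` (file `LiouvilleUnfoldingLogPrimitiveNLStubTransfer.lean`) derives the crux
from the min-normalisation stub and `Negative.BoundaryRigidity` by running the tree engine
`KZ.unfoldedLogStokes_mem_relations` once per monomial. This file isolates that single run: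

* `transfer_isSemialgebraicFunOn_comp_snoc` — a `ℚ`-semialgebraic function of `n + 1` variables
  evaluated along a `ℚ`-semialgebraic section `x ↦ (x, u x)` is `ℚ`-semialgebraic on the base;
* `transfer_exists_unfoldRep` — the unfolded monomial `[{x ∈ τ, 1 ≤ u ≤ W x}, h x/u]` is an honest
  `KZ.IntegralRep` as soon as `h · log W ∈ L¹(τ)` (Tonelli);
* `transfer_engine_of_hasDerivAt_zero` — the engine with a fibrewise-constant coefficient `H`
  (`H' = 0`, so the unfolded `[W]` of `∫ H' log V` has integrand `0` and is itself a relation);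
* `transfer_engineInstance` — the min-normalised instance: for `V > 0` on the band with fibre
  minimum `m ≤ V`, `m > 0` `ℚ`-semialgebraic on the base, the engine is run with `H = h ∘ Fin.init`,
  `Ṽ = V/m ≥ 1` and the `ℚ`-semialgebraic zero-extension `F` of the fibre velocity
  (`Engine.stub_velocityExtension`), `Ṽ' = F/m`; on open fibres `F = V'` (uniqueness of
  derivatives), and the graphs of `a`, `b` are null (`KZ.volume_graph_eq_zero`), so integrability
  of `H Ṽ'/Ṽ` is that of `h V'/V`. Output: representations `RB = [band, H Ṽ'/Ṽ]`,
  `Ub = [{1 ≤ u ≤ V(x, b x)/m x}, h x/u]`, `Ua = [{1 ≤ u ≤ V(x, a x)/m x}, −h x/u]` with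
  `[RB] − [Ub] − [Ua] ∈ KZ.relations` and `RB.integrand (x, t) = h x V'(x,t)/V(x,t)` on open fibres.
-/

noncomputable section

open Set MeasureTheory
open Literature.NumberTheory.Transcendental
open Literature.ModelTheory.ExponentialFields (IsSemialgebraic)

namespace Summit.KontsevichZagierPeriods.LiouvilleUnfolding.LogPrimitiveNL

/-- A `ℚ`-semialgebraic function `F` of `n + 1` variables evaluated along a `ℚ`-semialgebraic
section `x ↦ (x, u x)` of its domain `B` is `ℚ`-semialgebraic on the base: composition with the
semialgebraic map `x ↦ Fin.snoc x (u x)` (all of whose coordinates are semialgebraic functions,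
`IsSemialgebraicMapOn.of_forall`; composition by Basu–Pollack–Roy Prop. 2.84,
`IsSemialgebraicFunOn.comp_isSemialgebraicMapOn_holds`). [folklore] -/
theorem transfer_isSemialgebraicFunOn_comp_snoc {n : ℕ} {τ : Set (Fin n → ℝ)}
    {B : Set (Fin (n + 1) → ℝ)} {F : (Fin (n + 1) → ℝ) → ℝ} {u : (Fin n → ℝ) → ℝ}
    (hτ : IsSemialgebraic ℚ τ)
    (hF : IsSemialgebraicFunOn ℚ B F) (hu : IsSemialgebraicFunOn ℚ τ u)
    (hmem : ∀ x ∈ τ, (Fin.snoc x (u x) : Fin (n + 1) → ℝ) ∈ B) :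
    IsSemialgebraicFunOn ℚ τ (fun x => F (Fin.snoc x (u x))) := by
  have hmap : IsSemialgebraicMapOn ℚ τ (fun x => (Fin.snoc x (u x) : Fin (n + 1) → ℝ)) := by
    refine IsSemialgebraicMapOn.of_forall hτ fun j => ?_
    refine Fin.lastCases ?_ (fun i => ?_) j
    · simpa only [Fin.snoc_last] using hu
    · simpa only [Fin.snoc_castSucc] using
        Literature.NumberTheory.Transcendental.isSemialgebraicFunOn_apply hτ i
  exact IsSemialgebraicFunOn.comp_isSemialgebraicMapOn_holds hF hmap fun x hx => hmem x hx

/-- **The unfolded monomial is an honest representation.** For `h` and `W ≥ 1` `ℚ`-semialgebraic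
on a `ℚ`-semialgebraic `τ` with `h · log W ∈ L¹(τ)`, there is a `KZ.IntegralRep` with domain
`{(x, u) | x ∈ τ, 1 ≤ u ≤ W x}` and integrand `h x/u` (integrable by Tonelli:
`∫₁^{W x} |h x|/u du = |h x| log W x`, `KZlog.lintegral_enorm_div_Icc_one`,
`KZlog.integrableOn_band_of_lintegral_fibre_le`; cf. `KZlog.IntegralRep.monomialRep`). [folklore] -/
theorem transfer_exists_unfoldRep {n : ℕ} {τ : Set (Fin n → ℝ)} {h W : (Fin n → ℝ) → ℝ}
    (hτ : IsSemialgebraic ℚ τ) (hh : IsSemialgebraicFunOn ℚ τ h) (hW : IsSemialgebraicFunOn ℚ τ W)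
    (hW1 : ∀ x ∈ τ, 1 ≤ W x) (hint : IntegrableOn (fun x => h x * Real.log (W x)) τ) :
    ∃ U : KZ.IntegralRep (n + 1), U.domain = KZlog.band τ (fun _ => 1) W ∧
      U.integrand = fun z => h (Fin.init z) / z (Fin.last n) := by
  have hτm : MeasurableSet τ := IsSemialgebraic.measurableSet_holds hτ
  have hB : IsSemialgebraic ℚ (KZlog.band τ (fun _ => (1 : ℝ)) W) :=
    KZlog.isSemialgebraic_band (by simpa using isSemialgebraicFunOn_ratCast hτ 1) hW
  have hBm : MeasurableSet (KZlog.band τ (fun _ => (1 : ℝ)) W) :=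
    IsSemialgebraic.measurableSet_holds hB
  have hsa : IsSemialgebraicFunOn ℚ (KZlog.band τ (fun _ => (1 : ℝ)) W)
      (fun z => h (Fin.init z) / z (Fin.last n)) :=
    (hh.comp_init_mono hB KZ.band_subset_setOf_init_mem).div
      (Literature.NumberTheory.Transcendental.isSemialgebraicFunOn_apply hB (Fin.last n))
      fun z hz => (one_pos.trans_le hz.2.1).ne'
  have hintU : IntegrableOn (fun z => h (Fin.init z) / z (Fin.last n))
      (KZlog.band τ (fun _ => (1 : ℝ)) W) := by
    refine KZlog.integrableOn_band_of_lintegral_fibre_le (a := fun _ => (1 : ℝ)) (b := W) hτm hBm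
      (fun x t => KZlog.snoc_mem_band) (KZ.aestronglyMeasurable_of_isSemialgebraicFunOn hsa hBm)
      (K := fun x => h x * Real.log (W x)) (fun x hx => ?_) hint
    have e : ∀ t : ℝ, h (Fin.init (Fin.snoc x t : Fin (n + 1) → ℝ)) /
        (Fin.snoc x t : Fin (n + 1) → ℝ) (Fin.last n) = h x / t := fun t => by simp
    simp_rw [e]
    exact (KZlog.lintegral_enorm_div_Icc_one _ _ (hW1 x hx)).le
  exact ⟨⟨_, _, hB, hsa, hintU⟩, rfl, rfl⟩

/-- **The tree engine with a fibrewise-constant coefficient.** `KZ.unfoldedLogStokes_mem_relations`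
in the case `H' = 0` (the coefficient `H` is constant along the fibres): the unfolded
representation `W = [{(z, s) | z ∈ band, 1 ≤ s ≤ V z}, 0]` of `∫ H' log V` has integrand zero,
hence is itself a relation (`KZ.of_mem_relations_of_eqOn_zero`), and the unfolded logarithmic
Stokes formula reads `[band, H V'/V] − [Ub] − [Ua] ∈ KZ.relations`. [folklore] -/
theorem transfer_engine_of_hasDerivAt_zero {n : ℕ} {τ : Set (Fin n → ℝ)} {a b : (Fin n → ℝ) → ℝ}
    {H V V' : (Fin (n + 1) → ℝ) → ℝ}
    (hτ : IsSemialgebraic ℚ τ) (ha : IsSemialgebraicFunOn ℚ τ a) (hb : IsSemialgebraicFunOn ℚ τ b)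
    (hab : ∀ x ∈ τ, a x ≤ b x)
    (hH : IsSemialgebraicFunOn ℚ (KZlog.band τ a b) H)
    (hV : IsSemialgebraicFunOn ℚ (KZlog.band τ a b) V)
    (hV' : IsSemialgebraicFunOn ℚ (KZlog.band τ a b) V')
    (hV1 : ∀ z ∈ KZlog.band τ a b, 1 ≤ V z)
    (hcont : ∀ x ∈ τ, ContinuousOn (fun t : ℝ => H (Fin.snoc x t)) (Icc (a x) (b x)) ∧
      ContinuousOn (fun t : ℝ => V (Fin.snoc x t)) (Icc (a x) (b x)))
    (hder : ∀ x ∈ τ, ∀ t ∈ Ioo (a x) (b x),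
      HasDerivAt (fun s : ℝ => H (Fin.snoc x s)) 0 t ∧
      HasDerivAt (fun s : ℝ => V (Fin.snoc x s)) (V' (Fin.snoc x t)) t)
    (hintHV : IntegrableOn (fun z => H z * V' z / V z) (KZlog.band τ a b))
    (hHb : IsSemialgebraicFunOn ℚ τ fun x => H (Fin.snoc x (b x)))
    (hVb : IsSemialgebraicFunOn ℚ τ fun x => V (Fin.snoc x (b x)))
    (hHa : IsSemialgebraicFunOn ℚ τ fun x => H (Fin.snoc x (a x)))
    (hVa : IsSemialgebraicFunOn ℚ τ fun x => V (Fin.snoc x (a x)))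
    (hintb : IntegrableOn (fun x => H (Fin.snoc x (b x)) * Real.log (V (Fin.snoc x (b x)))) τ)
    (hinta : IntegrableOn (fun x => H (Fin.snoc x (a x)) * Real.log (V (Fin.snoc x (a x)))) τ)
    (RB Ub Ua : KZ.IntegralRep (n + 1))
    (hRBd : RB.domain = KZlog.band τ a b)
    (hRBi : EqOn RB.integrand (fun z => H z * V' z / V z) RB.domain)
    (hUbd : Ub.domain = KZlog.band τ (fun _ => 1) fun x => V (Fin.snoc x (b x)))
    (hUbi : EqOn Ub.integrand
      (fun z => H (Fin.snoc (Fin.init z) (b (Fin.init z))) / z (Fin.last n)) Ub.domain)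
    (hUad : Ua.domain = KZlog.band τ (fun _ => 1) fun x => V (Fin.snoc x (a x)))
    (hUai : EqOn Ua.integrand
      (fun z => -H (Fin.snoc (Fin.init z) (a (Fin.init z))) / z (Fin.last n)) Ua.domain) :
    KZ.of RB - KZ.of Ub - KZ.of Ua ∈ KZ.relations := by
  have hB : IsSemialgebraic ℚ (KZlog.band τ a b) := KZlog.isSemialgebraic_band ha hb
  have hQ : IsSemialgebraic ℚ (KZlog.band (KZlog.band τ a b) (fun _ => (1 : ℝ)) V) :=
    KZlog.isSemialgebraic_band (by simpa using isSemialgebraicFunOn_ratCast hB 1) hV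
  have h0B : IsSemialgebraicFunOn ℚ (KZlog.band τ a b) (fun _ => (0 : ℝ)) := by
    simpa using isSemialgebraicFunOn_ratCast hB 0
  have h0Q : IsSemialgebraicFunOn ℚ (KZlog.band (KZlog.band τ a b) (fun _ => (1 : ℝ)) V)
      (fun _ => (0 : ℝ)) := by
    simpa using isSemialgebraicFunOn_ratCast hQ 0
  let W : KZ.IntegralRep (n + 2) := ⟨_, fun _ => 0, hQ, h0Q, integrableOn_zero⟩
  have hW : KZ.of W ∈ KZ.relations := KZ.of_mem_relations_of_eqOn_zero W fun _ _ => rfl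
  have hintH' :
      IntegrableOn (fun z => (fun _ => (0 : ℝ)) z * Real.log (V z)) (KZlog.band τ a b) := by
    simp only [zero_mul]
    exact integrableOn_zero
  have key := KZ.unfoldedLogStokes_mem_relations (H' := fun _ => (0 : ℝ)) hτ ha hb hab hH h0B hV hV'
    hV1 hcont (fun x hx t ht => hder x hx t ht) hintHV hintH' hHb hVb hHa hVa hintb hinta RB W Ub Ua
    hRBd hRBi rfl (fun w _ => by simp [W]) hUbd hUbi hUad hUai
  have e : KZ.of RB - KZ.of Ub - KZ.of Ua =
      (KZ.of RB + KZ.of W - KZ.of Ub - KZ.of Ua) - KZ.of W := by abel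
  rw [e]
  exact KZ.relations.sub_mem key hW

/-- **The min-normalised instance of the engine.** Over a `ℚ`-semialgebraic base `τ` with
`ℚ`-semialgebraic edges `a ≤ b`, let `h` be `ℚ`-semialgebraic on `τ`, `V` `ℚ`-semialgebraic on the
band, continuous on closed fibres, with fibre derivative `V'` on open fibres and `h V'/V` integrable
on the band, and let `m > 0` be `ℚ`-semialgebraic on `τ` with `m x ≤ V (x, t)` on closed fibres (so
`V > 0`) and `h · log (V(·, b)/m)`, `h · log (V(·, a)/m)` integrable on `τ`. Then the tree engine,
run with `H = h ∘ Fin.init` (`H' = 0`), `Ṽ = V/m ≥ 1` and `Ṽ' = F/m` for the `ℚ`-semialgebraic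
zero-extension `F` of the fibre velocity (`Engine.stub_velocityExtension`; `F = V'` on open fibres
by uniqueness of derivatives, and the boundary graphs are null, `KZ.volume_graph_eq_zero`), yields
honest representations `RB = [band, H Ṽ'/Ṽ]` (integrand `= h V'/V` on open fibres),
`Ub = [{1 ≤ u ≤ V(x, b x)/m x}, h x/u]`, `Ua = [{1 ≤ u ≤ V(x, a x)/m x}, −h x/u]` with
`[RB] − [Ub] − [Ua] ∈ KZ.relations`. [folklore] -/
theorem transfer_engineInstance :
    ∀ (n : ℕ) (τ : Set (Fin n → ℝ)) (a b h m : (Fin n → ℝ) → ℝ) (V V' : (Fin (n + 1) → ℝ) → ℝ),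
      IsSemialgebraic ℚ τ → IsSemialgebraicFunOn ℚ τ a → IsSemialgebraicFunOn ℚ τ b →
      (∀ x ∈ τ, a x ≤ b x) → IsSemialgebraicFunOn ℚ τ h →
      IsSemialgebraicFunOn ℚ (KZlog.band τ a b) V →
      (∀ x ∈ τ, ContinuousOn (fun t : ℝ => V (Fin.snoc x t)) (Set.Icc (a x) (b x))) →
      (∀ x ∈ τ, ∀ t ∈ Set.Ioo (a x) (b x),
        HasDerivAt (fun s : ℝ => V (Fin.snoc x s)) (V' (Fin.snoc x t)) t) →
      IntegrableOn (fun z => h (Fin.init z) * V' z / V z) (KZlog.band τ a b) →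
      IsSemialgebraicFunOn ℚ τ m → (∀ x ∈ τ, 0 < m x) →
      (∀ x ∈ τ, ∀ t ∈ Set.Icc (a x) (b x), m x ≤ V (Fin.snoc x t)) →
      IntegrableOn (fun x => h x * Real.log (V (Fin.snoc x (b x)) / m x)) τ →
      IntegrableOn (fun x => h x * Real.log (V (Fin.snoc x (a x)) / m x)) τ →
      ∃ RB Ub Ua : KZ.IntegralRep (n + 1),
        RB.domain = KZlog.band τ a b ∧
        (∀ x ∈ τ, ∀ t ∈ Set.Ioo (a x) (b x),
          RB.integrand (Fin.snoc x t) = h x * V' (Fin.snoc x t) / V (Fin.snoc x t)) ∧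
        Ub.domain = KZlog.band τ (fun _ => 1) (fun x => V (Fin.snoc x (b x)) / m x) ∧
        (Ub.integrand = fun z => h (Fin.init z) / z (Fin.last n)) ∧
        Ua.domain = KZlog.band τ (fun _ => 1) (fun x => V (Fin.snoc x (a x)) / m x) ∧
        (Ua.integrand = fun z => -h (Fin.init z) / z (Fin.last n)) ∧
        KZ.of RB - KZ.of Ub - KZ.of Ua ∈ KZ.relations := by
  intro n τ a b h m V V' hτ ha hb hab hh hV hcont hderiv hint hm hm0 hmV hintb hinta
  obtain ⟨F, hF, hFder⟩ := Engine.stub_velocityExtension n τ a b V V' hτ ha hb hV hderiv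
  have hB : IsSemialgebraic ℚ (KZlog.band τ a b) := KZlog.isSemialgebraic_band ha hb
  have hBm : MeasurableSet (KZlog.band τ a b) := IsSemialgebraic.measurableSet_holds hB
  have hτm : MeasurableSet τ := IsSemialgebraic.measurableSet_holds hτ
  have hmemB : ∀ x ∈ τ, ∀ t ∈ Icc (a x) (b x),
      (Fin.snoc x t : Fin (n + 1) → ℝ) ∈ KZlog.band τ a b :=
    fun x hx t ht => KZlog.snoc_mem_band.2 ⟨hx, ht⟩
  have hm0' : ∀ x ∈ τ, m x ≠ 0 := fun x hx => (hm0 x hx).ne'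
  have hmB : IsSemialgebraicFunOn ℚ (KZlog.band τ a b) (fun z => m (Fin.init z)) :=
    hm.comp_init_mono hB KZ.band_subset_setOf_init_mem
  have hmB0 : ∀ z ∈ KZlog.band τ a b, m (Fin.init z) ≠ 0 := fun z hz => hm0' _ hz.1
  -- `F = V'` on the open band (uniqueness of derivatives)
  have hFV' : ∀ x ∈ τ, ∀ t ∈ Ioo (a x) (b x), F (Fin.snoc x t) = V' (Fin.snoc x t) :=
    fun x hx t ht => (hFder x hx t ht).unique (hderiv x hx t ht)
  -- the normalised data `H = h ∘ init`, `Ṽ = V/m`, `Ṽ' = F/m`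
  set H : (Fin (n + 1) → ℝ) → ℝ := fun z => h (Fin.init z) with hHdef
  set Vt : (Fin (n + 1) → ℝ) → ℝ := fun z => V z / m (Fin.init z) with hVt
  set Vt' : (Fin (n + 1) → ℝ) → ℝ := fun z => F z / m (Fin.init z) with hVt'
  have hHsa : IsSemialgebraicFunOn ℚ (KZlog.band τ a b) H :=
    hh.comp_init_mono hB KZ.band_subset_setOf_init_mem
  have hVtsa : IsSemialgebraicFunOn ℚ (KZlog.band τ a b) Vt := hV.div hmB hmB0
  have hVt'sa : IsSemialgebraicFunOn ℚ (KZlog.band τ a b) Vt' := hF.div hmB hmB0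
  have hVt1 : ∀ z ∈ KZlog.band τ a b, 1 ≤ Vt z := by
    intro z hz
    have h1 := hmV (Fin.init z) hz.1 (z (Fin.last n)) ⟨hz.2.1, hz.2.2⟩
    rw [Fin.snoc_init_self] at h1
    exact (one_le_div (hm0 _ hz.1)).2 h1
  -- the key pointwise identity on open fibres
  have hkey : ∀ x ∈ τ, ∀ t ∈ Ioo (a x) (b x),
      H (Fin.snoc x t) * Vt' (Fin.snoc x t) / Vt (Fin.snoc x t) =
        h x * V' (Fin.snoc x t) / V (Fin.snoc x t) := by
    intro x hx t ht
    simp only [hHdef, hVt, hVt', Fin.init_snoc]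
    rw [hFV' x hx t ht, mul_div_assoc, div_div_div_cancel_right₀ (hm0' x hx), ← mul_div_assoc]
  -- integrability of `H Ṽ'/Ṽ` on the band: a.e. equal to `h V'/V` (off the null boundary graphs)
  have hN0 : volume ({z : Fin (n + 1) → ℝ | Fin.init z ∈ τ ∧ z (Fin.last n) = a (Fin.init z)} ∪
      {z : Fin (n + 1) → ℝ | Fin.init z ∈ τ ∧ z (Fin.last n) = b (Fin.init z)}) = 0 :=
    measure_union_null (KZ.volume_graph_eq_zero ha) (KZ.volume_graph_eq_zero hb)
  have hintHV : IntegrableOn (fun z => H z * Vt' z / Vt z) (KZlog.band τ a b) := by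
    refine hint.congr_fun_ae ?_
    filter_upwards [ae_restrict_mem hBm, ae_restrict_of_ae (compl_mem_ae_iff.2 hN0)] with z hz hzN
    have hx : Fin.init z ∈ τ := hz.1
    have hta : a (Fin.init z) < z (Fin.last n) :=
      lt_of_le_of_ne hz.2.1 fun e => hzN (Or.inl ⟨hx, e.symm⟩)
    have htb : z (Fin.last n) < b (Fin.init z) :=
      lt_of_le_of_ne hz.2.2 fun e => hzN (Or.inr ⟨hx, e⟩)
    have e := hkey (Fin.init z) hx (z (Fin.last n)) ⟨hta, htb⟩
    rw [Fin.snoc_init_self] at e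
    exact e.symm
  -- the boundary sections
  have hVb : IsSemialgebraicFunOn ℚ τ (fun x => V (Fin.snoc x (b x))) :=
    transfer_isSemialgebraicFunOn_comp_snoc hτ hV hb fun x hx => hmemB x hx _ ⟨hab x hx, le_rfl⟩
  have hVa : IsSemialgebraicFunOn ℚ τ (fun x => V (Fin.snoc x (a x))) :=
    transfer_isSemialgebraicFunOn_comp_snoc hτ hV ha fun x hx => hmemB x hx _ ⟨le_rfl, hab x hx⟩
  have hWb : IsSemialgebraicFunOn ℚ τ (fun x => V (Fin.snoc x (b x)) / m x) := hVb.div hm hm0'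
  have hWa : IsSemialgebraicFunOn ℚ τ (fun x => V (Fin.snoc x (a x)) / m x) := hVa.div hm hm0'
  have hWb1 : ∀ x ∈ τ, 1 ≤ V (Fin.snoc x (b x)) / m x := fun x hx =>
    (one_le_div (hm0 x hx)).2 (hmV x hx _ ⟨hab x hx, le_rfl⟩)
  have hWa1 : ∀ x ∈ τ, 1 ≤ V (Fin.snoc x (a x)) / m x := fun x hx =>
    (one_le_div (hm0 x hx)).2 (hmV x hx _ ⟨le_rfl, hab x hx⟩)
  -- the three representations
  let RB : KZ.IntegralRep (n + 1) := ⟨KZlog.band τ a b, fun z => H z * Vt' z / Vt z, hB,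
    (IsSemialgebraicFunOn.mul_holds hHsa hVt'sa).div hVtsa
      fun z hz => (one_pos.trans_le (hVt1 z hz)).ne', hintHV⟩
  obtain ⟨Ub, hUbd, hUbi⟩ := transfer_exists_unfoldRep hτ hh hWb hWb1 hintb
  have hinta' : IntegrableOn (fun x => -h x * Real.log (V (Fin.snoc x (a x)) / m x)) τ := by
    simpa [neg_mul] using hinta.neg
  obtain ⟨Ua, hUad, hUai⟩ :=
    transfer_exists_unfoldRep (h := fun x => -h x) hτ (hh.neg.congr fun _ _ => rfl) hWa hWa1 hinta'
  have hrel : KZ.of RB - KZ.of Ub - KZ.of Ua ∈ KZ.relations := by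
    refine transfer_engine_of_hasDerivAt_zero (H := H) (V := Vt) (V' := Vt') hτ ha hb hab hHsa hVtsa
      hVt'sa hVt1 (fun x hx => ⟨?_, ?_⟩) (fun x hx t ht => ⟨?_, ?_⟩) hintHV ?_ ?_ ?_ ?_ ?_ ?_ RB Ub Ua rfl
      (fun _ _ => rfl) ?_ ?_ ?_ ?_
    · simp only [hHdef, Fin.init_snoc]
      exact continuousOn_const
    · simp only [hVt, Fin.init_snoc]
      exact (hcont x hx).div_const _
    · simp only [hHdef, Fin.init_snoc]
      exact hasDerivAt_const t (h x)
    · simp only [hVt, hVt', Fin.init_snoc]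
      exact (hFder x hx t ht).div_const _
    · exact hh.congr fun x _ => by simp [hHdef]
    · exact hWb.congr fun x _ => by simp [hVt]
    · exact hh.congr fun x _ => by simp [hHdef]
    · exact hWa.congr fun x _ => by simp [hVt]
    · exact hintb.congr_fun (fun x _ => by simp [hHdef, hVt]) hτm
    · exact hinta.congr_fun (fun x _ => by simp [hHdef, hVt]) hτm
    · rw [hUbd]
      exact KZlog.band_congr fun x _ => by simp [hVt]
    · intro z _
      simp [hUbi, hHdef]
    · rw [hUad]
      exact KZlog.band_congr fun x _ => by simp [hVt]
    · intro z _
      simp [hUai, hHdef]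
  exact ⟨RB, Ub, Ua, rfl, fun x hx t ht => hkey x hx t ht, hUbd, hUbi, hUad, hUai, hrel⟩

end Summit.KontsevichZagierPeriods.LiouvilleUnfolding.LogPrimitiveNL

end
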